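import Literature.Barriers.ValiantsHypothesis.CT23ExplicitAnnihilatorCircuitSignConst
import Literature.Computability.AlgebraicComplexity.ConstantFreeNumerals
import HarnessLib

/-!
# A constant-free circuit for the encoder skeleton (Chatterjee–Tengse arXiv:2309.07612v2,
# Lemma 3.5 = v1 Lemma 42, "constant-free, algebraic expressions"; val-lit p2 g8, X-CT23 engine
# brick E-e′, file 5 — the skeleton half of interface R4 of the assembly seat)

Theorem-only (plus plumbing `def`s: the INTEGER templates of the gadgets and of the skeleton)
companion of `CT23ExplicitAnnihilatorCircuitSignConst.lean`; NO named facts. Honest framing: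
circuit bookkeeping for a printed `VPSPACE` construction (consequences-side literature); it
discharges nothing by itself; `VP ≠ VNP` is NOT proved and nothing here bears on it.

The generic encoder `encCircuitWith A S …` (file 4) is constant-free as soon as its stage-A
circuits `A k` (the Kronecker coordinates `pow(i)_k`; supplied for `α ∈ ℕ` by the numerals brick,
val-lit t20) and its skeleton circuit `S` are. This file supplies `S`: the skeleton with
placeholder rows `encoderSkeleton x a b Kb (X ∘ p)` has only the constants `0, ±1`, so it is the
image under `ℤ → F` of an INTEGER template `skeletonZ` (`map_skeletonZ`), whose constant-free
complexity is bounded by the same polynomial `skelBoundPoly n δ` as in file 4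
(`constantFreeComplexity_skeletonZ_le`, the tree's `τ`-calculus of
`AC/ConstantFreeCircuits.lean`), and t20's `ArithCircuit.exists_signConst_map_int`
(`AC/ConstantFreeNumerals.lean`) turns the `τ`-minimal integer circuit into a fan-in-two
sign-constant circuit over `F` (`exists_signConst_skeleton`). Packaged with file 4:
`exists_encoderCircuit_signConst_of_kronPow` — given sign-constant circuits for the `pow`
coordinates (hypothesis), the encoder circuit is fan-in two, CONSTANT-FREE, of size
`≤ n·s + m·sA + skelBoundPoly n δ`, projects only `ws`, and computes the encoder at the rows
`(G t)(pow(i))`.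

## References

* [ChatterjeeTengse2023] P. Chatterjee, A. Tengse, *Lower Bounds from Succinct Hitting Sets*,
  arXiv:2309.07612v2, Lemma 3.5 and its proof (v1: Lemma 42, p0015.txt:L80–L102, p0016.txt:L1–L8),
  Obs. 2.9 (v1: Obs. 17).
* [Burgisser2000] P. Bürgisser, *Completeness and Reduction in Algebraic Complexity Theory*,
  Springer 2000, §1.4, §4.1 (constant-free circuits, extension of scalars).
-/

noncomputable section

open MvPolynomial

namespace Literature.Barriers.ValiantsHypothesis

namespace CT23Encoder

open Literature.Computability.AlgebraicComplexity BitGadget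

universe u v

variable {F : Type u} [Field F] {τ : Type v} [DecidableEq τ]

/-! ### §1 Integer templates of the gadget inputs and of the skeleton -/

section Templates

variable {n δ L : ℕ}

/-- The row block as INTEGER gadget inputs. [cite: ChatterjeeTengse2023, Lemma 3.5 (v1: Lemma 42; p0015.txt:L96–L99)] -/
def varVecZ (a : Fin L → τ) : Fin L → MvPolynomial τ ℤ := fun l => X (a l)

/-- A constant bit-vector as INTEGER gadget inputs. [cite: ChatterjeeTengse2023, Lemma 3.5 (v1: Lemma 42; p0016.txt:L2)] -/
def constVecZ (Kb : Fin L → Bool) : Fin L → MvPolynomial τ ℤ := fun l => bitVal (Kb l)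

/-- Integer template of the activity polynomial `1 − GT(·, k)`. [cite: ChatterjeeTengse2023, Lemma 3.5 (v1: Lemma 42)] -/
def actPolyZ (a : Fin (n * δ) → τ) (Kb : Fin (n * δ) → Bool) : MvPolynomial τ ℤ :=
  1 - GT (n * δ) (varVecZ a) (constVecZ Kb)

/-- Integer template of `ROW(i)_t` over a family. [cite: ChatterjeeTengse2023, Lemma 3.5, `ROW` (v1: Lemma 42; p0015.txt:L97)] -/
def rowPolyGZ (x : Fin n → τ) (a : Fin (n * δ) → τ) (Kb : Fin (n * δ) → Bool)
    (g : Fin n → MvPolynomial τ ℤ) (t : Fin n) : MvPolynomial τ ℤ :=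
  BitGadget.LT (n * δ) (varVecZ a) (constVecZ Kb) * g t + EQ (n * δ) (varVecZ a) (constVecZ Kb) * X (x t)

/-- Integer template of the column power. [cite: ChatterjeeTengse2023, Lemma 3.5, `M̃_G(i,j)` (v1: Lemma 42; p0015.txt:L99)] -/
def colPowZ (b : Fin (n * δ) → τ) (R : MvPolynomial τ ℤ) (t : Fin n) : MvPolynomial τ ℤ :=
  ∏ β : Fin δ, (X (b (finProdFinEquiv (t, β))) * R ^ (2 ^ (β : ℕ)) + (1 - X (b (finProdFinEquiv (t, β)))))

/-- **Integer template of the encoder skeleton** (constants `0, ±1` only).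
[cite: ChatterjeeTengse2023, Lemma 3.5 (v1: Lemma 42; p0015.txt:L96–L99)] -/
def skeletonZ (x : Fin n → τ) (a b : Fin (n * δ) → τ) (Kb : Fin (n * δ) → Bool)
    (g : Fin n → MvPolynomial τ ℤ) : MvPolynomial τ ℤ :=
  actPolyZ a Kb * actPolyZ b Kb * (∏ t : Fin n, colPowZ b (rowPolyGZ x a Kb g t) t) +
    (1 - actPolyZ b Kb) * EQ (n * δ) (varVecZ a) (varVecZ b)

end Templates

/-! ### §2 The skeleton is the image of its integer template -/

section BaseChange

variable {n δ L : ℕ}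

omit [DecidableEq τ] in
/-- Base change of the row-block inputs. [cite: Burgisser2000, §4.1] -/
private theorem map_comp_varVecZ (a : Fin L → τ) :
    (⇑(MvPolynomial.map (Int.castRingHom F)) ∘ varVecZ (τ := τ) a) = varVec (F := F) a := by
  funext l; simp [varVecZ, varVec]

omit [DecidableEq τ] in
/-- Base change of the constant inputs. [cite: Burgisser2000, §4.1] -/
private theorem map_comp_constVecZ (Kb : Fin L → Bool) :
    (⇑(MvPolynomial.map (Int.castRingHom F)) ∘ constVecZ (τ := τ) Kb) = constVec (F := F) (τ := τ) Kb := by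
  funext l; cases h : Kb l <;> simp [constVecZ, constVec, bitVal, h]

omit [DecidableEq τ] in
/-- **The encoder skeleton with placeholder rows is the image of its integer template** under
`ℤ → F`. [cite: ChatterjeeTengse2023, Lemma 3.5 (v1: Lemma 42); Burgisser2000, §4.1] -/
theorem map_skeletonZ (x : Fin n → τ) (a b : Fin (n * δ) → τ) (Kb : Fin (n * δ) → Bool) (p : Fin n → τ) :
    MvPolynomial.map (Int.castRingHom F) (skeletonZ x a b Kb (fun t => X (p t))) =
      encoderSkeleton x a b Kb (fun t => (X (p t) : MvPolynomial τ F)) := by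
  simp only [skeletonZ, encoderSkeleton, actPolyZ, actPoly, rowPolyGZ, rowPolyG, colPowZ, colPow,
    map_add, map_mul, map_sub, map_one, map_prod, map_pow, map_X, map_EQ, map_LT, map_GT,
    map_comp_varVecZ, map_comp_constVecZ]

end BaseChange

/-! ### §3 Constant-free complexity of the integer template -/

section Tau

variable {σ : Type*}

/-- `τ(eqBit u v) ≤ 2(τ u + τ v) + 7`. [cite: ChatterjeeTengse2023, Obs. 2.9 "constant-free circuits of size `O(ℓ²)`" (v1: Obs. 17)] -/
theorem constantFreeComplexity_eqBit_le (u v : MvPolynomial σ ℤ) :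
    constantFreeComplexity (eqBit u v) ≤ 2 * (constantFreeComplexity u + constantFreeComplexity v) + 7 := by
  rw [eqBit]
  have h1 := constantFreeComplexity_mul_le u v
  have h2 := constantFreeComplexity_mul_le (1 - u) (1 - v)
  have h3 := constantFreeComplexity_sub_le 1 u
  have h4 := constantFreeComplexity_sub_le 1 v
  have h5 := constantFreeComplexity_add_le (u * v) ((1 - u) * (1 - v))
  have h6 : constantFreeComplexity (1 : MvPolynomial σ ℤ) = 0 := constantFreeComplexity_one
  omega

/-- **`τ(EQ_ℓ) ≤ ℓ(4c₀ + 8)`** on inputs of constant-free complexity `≤ c₀`.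
[cite: ChatterjeeTengse2023, Obs. 2.9 (v1: Obs. 17)] -/
theorem constantFreeComplexity_EQ_le (c₀ : ℕ) : ∀ (ℓ : ℕ) (u v : Fin ℓ → MvPolynomial σ ℤ),
    (∀ i, constantFreeComplexity (u i) ≤ c₀) → (∀ i, constantFreeComplexity (v i) ≤ c₀) →
      constantFreeComplexity (BitGadget.EQ ℓ u v) ≤ ℓ * (4 * c₀ + 8)
  | 0, u, v, _, _ => by simp [BitGadget.EQ, constantFreeComplexity_one]
  | ℓ + 1, u, v, hu, hv => by
    rw [BitGadget.EQ]
    have h1 := constantFreeComplexity_eqBit_le (u 0) (v 0)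
    have h2 := constantFreeComplexity_EQ_le c₀ ℓ (Fin.tail u) (Fin.tail v) (fun i => hu _) (fun i => hv _)
    have h3 := constantFreeComplexity_mul_le (eqBit (u 0) (v 0)) (EQ ℓ (Fin.tail u) (Fin.tail v))
    have hu0 := hu 0
    have hv0 := hv 0
    nlinarith

/-- **`τ(LT_ℓ) ≤ ℓ(ℓ(4c₀+8) + 2c₀ + 5)`**. [cite: ChatterjeeTengse2023, Obs. 2.9 (v1: Obs. 17)] -/
theorem constantFreeComplexity_LT_le (c₀ : ℕ) : ∀ (ℓ : ℕ) (u v : Fin ℓ → MvPolynomial σ ℤ),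
    (∀ i, constantFreeComplexity (u i) ≤ c₀) → (∀ i, constantFreeComplexity (v i) ≤ c₀) →
      constantFreeComplexity (BitGadget.LT ℓ u v) ≤ ℓ * (ℓ * (4 * c₀ + 8) + 2 * c₀ + 5)
  | 0, u, v, _, _ => by simp [BitGadget.LT, constantFreeComplexity_zero]
  | ℓ + 1, u, v, hu, hv => by
    rw [BitGadget.LT]
    have h1 := constantFreeComplexity_sub_le 1 (u 0)
    have h0 : constantFreeComplexity (1 : MvPolynomial σ ℤ) = 0 := constantFreeComplexity_one
    have h2 := constantFreeComplexity_mul_le (1 - u 0) (v 0)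
    have h3 := constantFreeComplexity_EQ_le c₀ ℓ (Fin.tail u) (Fin.tail v) (fun i => hu _) (fun i => hv _)
    have h4 := constantFreeComplexity_mul_le ((1 - u 0) * v 0) (EQ ℓ (Fin.tail u) (Fin.tail v))
    have h5 := constantFreeComplexity_LT_le c₀ ℓ (Fin.tail u) (Fin.tail v) (fun i => hu _) (fun i => hv _)
    have h6 := constantFreeComplexity_add_le ((1 - u 0) * v 0 * EQ ℓ (Fin.tail u) (Fin.tail v))
      (BitGadget.LT ℓ (Fin.tail u) (Fin.tail v))
    have hu0 := hu 0
    have hv0 := hv 0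
    nlinarith

/-- **`τ(GT_ℓ)`**: the same bound. [cite: ChatterjeeTengse2023, Obs. 2.9 (v1: Obs. 17)] -/
theorem constantFreeComplexity_GT_le (c₀ : ℕ) (ℓ : ℕ) (u v : Fin ℓ → MvPolynomial σ ℤ)
    (hu : ∀ i, constantFreeComplexity (u i) ≤ c₀) (hv : ∀ i, constantFreeComplexity (v i) ≤ c₀) :
    constantFreeComplexity (BitGadget.GT ℓ u v) ≤ ℓ * (ℓ * (4 * c₀ + 8) + 2 * c₀ + 5) :=
  constantFreeComplexity_LT_le c₀ ℓ v u hv hu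

variable {n δ : ℕ}

omit [DecidableEq τ] in
/-- **`τ(integer skeleton template) ≤ skelBoundPoly n δ`** (the same polynomial count as over `F`).
[cite: ChatterjeeTengse2023, Lemma 3.5, size count (v1: Lemma 42; p0016.txt:L5–L8)] -/
theorem constantFreeComplexity_skeletonZ_le (x : Fin n → τ) (a b : Fin (n * δ) → τ)
    (Kb : Fin (n * δ) → Bool) (p : Fin n → τ) :
    constantFreeComplexity (skeletonZ x a b Kb (fun t => (X (p t) : MvPolynomial τ ℤ))) ≤ skelBoundPoly n δ := by
  have h1Z : constantFreeComplexity (1 : MvPolynomial τ ℤ) = 0 := constantFreeComplexity_one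
  have hv : ∀ (c : Fin (n * δ) → τ) (l : Fin (n * δ)), constantFreeComplexity (varVecZ (τ := τ) c l) ≤ 0 :=
    fun c l => (constantFreeComplexity_X (c l)).le
  have hc : ∀ l : Fin (n * δ), constantFreeComplexity (constVecZ (τ := τ) Kb l) ≤ 0 := fun l => by
    cases h : Kb l
    · simp [constVecZ, bitVal, h, constantFreeComplexity_zero]
    · simp [constVecZ, bitVal, h, constantFreeComplexity_one]
  have hLT : constantFreeComplexity (BitGadget.LT (n * δ) (varVecZ (τ := τ) a) (constVecZ Kb)) ≤
      (n * δ) * ((n * δ) * 8 + 5) := by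
    simpa using constantFreeComplexity_LT_le 0 (n * δ) (varVecZ a) (constVecZ Kb) (hv a) hc
  have hEQ : constantFreeComplexity (EQ (n * δ) (varVecZ (τ := τ) a) (constVecZ Kb)) ≤ (n * δ) * 8 := by
    simpa using constantFreeComplexity_EQ_le 0 (n * δ) (varVecZ a) (constVecZ Kb) (hv a) hc
  have hGTa : constantFreeComplexity (GT (n * δ) (varVecZ (τ := τ) a) (constVecZ Kb)) ≤
      (n * δ) * ((n * δ) * 8 + 5) := by
    simpa using constantFreeComplexity_GT_le 0 (n * δ) (varVecZ a) (constVecZ Kb) (hv a) hc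
  have hGTb : constantFreeComplexity (GT (n * δ) (varVecZ (τ := τ) b) (constVecZ Kb)) ≤
      (n * δ) * ((n * δ) * 8 + 5) := by
    simpa using constantFreeComplexity_GT_le 0 (n * δ) (varVecZ b) (constVecZ Kb) (hv b) hc
  have hEQab : constantFreeComplexity (EQ (n * δ) (varVecZ (τ := τ) a) (varVecZ b)) ≤ (n * δ) * 8 := by
    simpa using constantFreeComplexity_EQ_le 0 (n * δ) (varVecZ a) (varVecZ b) (hv a) (hv b)
  have hactA : constantFreeComplexity (actPolyZ (τ := τ) a Kb) ≤ (n * δ) * ((n * δ) * 8 + 5) + 2 := by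
    have := constantFreeComplexity_sub_le 1 (GT (n * δ) (varVecZ (τ := τ) a) (constVecZ Kb))
    rw [actPolyZ]; omega
  have hactB : constantFreeComplexity (actPolyZ (τ := τ) b Kb) ≤ (n * δ) * ((n * δ) * 8 + 5) + 2 := by
    have := constantFreeComplexity_sub_le 1 (GT (n * δ) (varVecZ (τ := τ) b) (constVecZ Kb))
    rw [actPolyZ]; omega
  have hrow : ∀ t, constantFreeComplexity (rowPolyGZ x a Kb (fun t => (X (p t) : MvPolynomial τ ℤ)) t) ≤
      (n * δ) * ((n * δ) * 8 + 5) + 8 * (n * δ) + 3 := by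
    intro t
    rw [rowPolyGZ]
    have h1 := constantFreeComplexity_mul_le (BitGadget.LT (n * δ) (varVecZ (τ := τ) a) (constVecZ Kb)) (X (p t))
    have h2 := constantFreeComplexity_mul_le (EQ (n * δ) (varVecZ (τ := τ) a) (constVecZ Kb)) (X (x t))
    have h3 := constantFreeComplexity_add_le (BitGadget.LT (n * δ) (varVecZ (τ := τ) a) (constVecZ Kb) * X (p t))
      (EQ (n * δ) (varVecZ (τ := τ) a) (constVecZ Kb) * X (x t))
    have h4 := constantFreeComplexity_X (σ := τ) (p t)
    have h5 := constantFreeComplexity_X (σ := τ) (x t)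
    omega
  have hcol : ∀ t, constantFreeComplexity (colPowZ b (rowPolyGZ x a Kb (fun t => (X (p t) : MvPolynomial τ ℤ)) t) t) ≤
      δ * ((n * δ) * ((n * δ) * 8 + 5) + 8 * (n * δ) + 3 + δ + 4) + δ := by
    intro t
    have h7 := hrow t
    rw [colPowZ]
    set R := rowPolyGZ x a Kb (fun t => (X (p t) : MvPolynomial τ ℤ)) t with hR
    have hfac : ∀ β : Fin δ, constantFreeComplexity ((X (b (finProdFinEquiv (t, β))) * R ^ (2 ^ (β : ℕ)) +
        (1 - X (b (finProdFinEquiv (t, β))))) : MvPolynomial τ ℤ) ≤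
        (n * δ) * ((n * δ) * 8 + 5) + 8 * (n * δ) + 3 + δ + 4 := by
      intro β
      have h1 := constantFreeComplexity_pow_two_pow_le R (β : ℕ)
      have h2 : (β : ℕ) ≤ δ := β.isLt.le
      have h3 := constantFreeComplexity_mul_le (X (b (finProdFinEquiv (t, β))) : MvPolynomial τ ℤ) (R ^ (2 ^ (β : ℕ)))
      have h4 := constantFreeComplexity_sub_le (1 : MvPolynomial τ ℤ) (X (b (finProdFinEquiv (t, β))))
      have h5 := constantFreeComplexity_add_le (X (b (finProdFinEquiv (t, β))) * R ^ (2 ^ (β : ℕ)) : MvPolynomial τ ℤ)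
        (1 - X (b (finProdFinEquiv (t, β))))
      have h6 := constantFreeComplexity_X (σ := τ) (b (finProdFinEquiv (t, β)))
      omega
    have hprod := constantFreeComplexity_finset_prod_le (Finset.univ : Finset (Fin δ))
      (fun β => ((X (b (finProdFinEquiv (t, β))) * R ^ (2 ^ (β : ℕ)) +
        (1 - X (b (finProdFinEquiv (t, β))))) : MvPolynomial τ ℤ))
    rw [Finset.card_univ, Fintype.card_fin] at hprod
    refine hprod.trans ?_
    have := Finset.sum_le_sum (s := (Finset.univ : Finset (Fin δ))) fun β _ => hfac β
    rw [Finset.sum_const, Finset.card_univ, Fintype.card_fin, smul_eq_mul] at this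
    omega
  have hcore : constantFreeComplexity (∏ t : Fin n, colPowZ b (rowPolyGZ x a Kb (fun t => (X (p t) : MvPolynomial τ ℤ)) t) t) ≤
      n * (δ * ((n * δ) * ((n * δ) * 8 + 5) + 8 * (n * δ) + 3 + δ + 4) + δ) + n := by
    have hprod := constantFreeComplexity_finset_prod_le (Finset.univ : Finset (Fin n))
      (fun t => colPowZ b (rowPolyGZ x a Kb (fun t => (X (p t) : MvPolynomial τ ℤ)) t) t)
    rw [Finset.card_univ, Fintype.card_fin] at hprod
    refine hprod.trans ?_
    have := Finset.sum_le_sum (s := (Finset.univ : Finset (Fin n))) fun t _ => hcol t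
    rw [Finset.sum_const, Finset.card_univ, Fintype.card_fin, smul_eq_mul] at this
    omega
  rw [skeletonZ]
  have h1 := constantFreeComplexity_mul_le (actPolyZ (τ := τ) a Kb) (actPolyZ b Kb)
  have h2 := constantFreeComplexity_mul_le (actPolyZ (τ := τ) a Kb * actPolyZ b Kb)
    (∏ t : Fin n, colPowZ b (rowPolyGZ x a Kb (fun t => (X (p t) : MvPolynomial τ ℤ)) t) t)
  have h3 := constantFreeComplexity_sub_le 1 (actPolyZ (τ := τ) b Kb)
  have h4 := constantFreeComplexity_mul_le (1 - actPolyZ (τ := τ) b Kb) (EQ (n * δ) (varVecZ (τ := τ) a) (varVecZ b))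
  have h5 := constantFreeComplexity_add_le
    (actPolyZ (τ := τ) a Kb * actPolyZ b Kb *
      ∏ t : Fin n, colPowZ b (rowPolyGZ x a Kb (fun t => (X (p t) : MvPolynomial τ ℤ)) t) t)
    ((1 - actPolyZ (τ := τ) b Kb) * EQ (n * δ) (varVecZ (τ := τ) a) (varVecZ b))
  simp only [skelBoundPoly]
  omega

end Tau

/-! ### §4 The constant-free skeleton circuit and the packaged R4 statement -/

section SignConst

variable {n m δ w : ℕ}

omit [DecidableEq τ] in
/-- **A constant-free fan-in-two circuit for the encoder skeleton with placeholder rows**, of size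
`≤ skelBoundPoly n δ`: the `τ`-minimal integer circuit for `skeletonZ`, base-changed to `F`.
[cite: ChatterjeeTengse2023, Lemma 3.5 "constant-free, algebraic expressions" (v1: Lemma 42; p0016.txt:L4–L8)] -/
theorem exists_signConst_skeleton (x : Fin n → τ) (a b : Fin (n * δ) → τ) (Kb : Fin (n * δ) → Bool)
    (p : Fin n → τ) :
    ∃ S : ArithCircuit F τ, S.IsFanInTwo ∧ S.HasSignConstants ∧
      S.Computes (encoderSkeleton x a b Kb (fun t => (X (p t) : MvPolynomial τ F))) ∧
      S.size ≤ skelBoundPoly n δ := by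
  obtain ⟨S, h2, hsc, hc, hs⟩ :=
    ArithCircuit.exists_signConst_map_int (k := F) (skeletonZ x a b Kb (fun t => (X (p t) : MvPolynomial τ ℤ)))
  refine ⟨S, h2, hsc, ?_, ?_⟩
  · rw [ArithCircuit.Computes, ← map_skeletonZ]; exact hc
  · rw [hs]; exact constantFreeComplexity_skeletonZ_le x a b Kb p

/-- **Lemma 3.5, constant-free circuit form (R4 of the assembly seat), modulo the `pow`
circuits.** Given `n` INPUT-FREE constant-free fan-in-two row circuits `Q_t` of size `≤ s`
computing `G t`, and constant-free fan-in-two circuits of size `≤ sA` for the Kronecker coordinates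
`kronPow a α Δ k` (for `α ∈ ℕ` these are the square-and-multiply numerals of the numerals brick),
there is a CONSTANT-FREE fan-in-two projection circuit of size `≤ n·s + m·sA + skelBoundPoly n δ`
computing the encoder at the rows `(G t)(pow(i))` and projecting only `ws`.
[cite: ChatterjeeTengse2023, Lemma 3.5 (v1: Lemma 42; p0015.txt:L74–L102, p0016.txt:L1–L8)] -/
theorem exists_encoderCircuit_signConst_of_kronPow {x : Fin n → τ} {a b : Fin (n * δ) → τ}
    {p : Fin n → τ} {ws : Fin w → τ} (lay : CircLayout x a b p ws) (dflt : τ)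
    (Kb : Fin (n * δ) → Bool) (α : F) (Δ : ℕ) (G : Fin n → MvPolynomial (Fin m) F)
    (Q : Fin n → ProjCircuit F (Fin m ⊕ Fin w)) {s sA : ℕ}
    (hQ2 : ∀ t, (Q t).IsFanInTwo) (hQc : ∀ t, (Q t).Computes (rename Sum.inl (G t)))
    (hQs : ∀ t, (Q t).size ≤ s) (hQp : ∀ t, (Q t).projVars ⊆ Set.range Sum.inr)
    (hQsc : ∀ t, (Q t).HasSignConstants)
    (hA : ∀ k : Fin m, ∃ P : ArithCircuit F τ, P.IsFanInTwo ∧ P.HasSignConstants ∧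
      P.Computes (kronPow a α Δ k) ∧ P.size ≤ sA) :
    ∃ C : ProjCircuit F τ, C.IsFanInTwo ∧ C.HasSignConstants ∧
      C.Computes (encoderSkeleton x a b Kb (fun t => gKron a α Δ (G t))) ∧
      C.size ≤ n * s + m * sA + skelBoundPoly n δ ∧ C.projVars ⊆ Set.range ws := by
  choose A hA2 hAsc hAc hAs using hA
  obtain ⟨S, hS2, hSsc, hSc, hSs⟩ := exists_signConst_skeleton (F := F) x a b Kb p
  obtain ⟨C, h1, h2, h3, h4, h5⟩ := exists_encoderCircuit_signConst lay dflt Kb α Δ G Q hQ2 hQc hQs hQp hQsc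
    A hA2 hAc hAs hAsc S hS2 hSc hSsc
  exact ⟨C, h1, h2, h3, h4.trans (by omega), h5⟩

end SignConst

end CT23Encoder

end Literature.Barriers.ValiantsHypothesis
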